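import Mathlib
import HarnessLib
import Summits.ValiantsHypothesis.ValiantsHypothesis.Theses.MonotoneRestoration
import Summits.ValiantsHypothesis.ValiantsHypothesis.Theorems.MonotoneRestorationOrbitRestorationLinearVolumeQPHomPolyBasics
import Literature.Computability.AlgebraicComplexity.BurgisserTransferProofs

/-!
# R1 (`OrbitRestorationLinearVolumeQP`, stmt-ValiantsHypothesis-18294): EDGE TRUNCATION —
# in the linear-volume class the patterns may be assumed to have polynomially many edges

Route MonotoneRestoration, aside R1, line `birth` (after K2/K3 the item rests on `stub_lvNarrowSpan`, the
linear-volume narrow-span statement).  The hypothesis class of R1 — level by level a combination of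
`≤ (n+2)^c` homomorphism polynomials of bipartite multigraph patterns with `≤ c (n+1)` vertices — puts NO bound
on the number of (parallel) edges of the patterns, i.e. on the degrees of the summands.  This file records the
first use of the `VP` hypothesis every attack on `stub_lvNarrowSpan` starts with: `hom_{F,n}` is homogeneous of
degree `|E(F)|` (`HomPolyBasics.isHomogeneous_homPoly`), so in a combination of total degree `≤ d` the summands
with `|E| > d` cancel among themselves and can be DROPPED:

* `sum_homPoly_eq_sum_filter_card_le` — one level: if `Σ_i α_i · hom_{F_i,n}` has total degree `≤ d`, it equals
  the sub-sum over the patterns with `|E(F_i)| ≤ d`;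
* `exists_edgeTruncated` — family form: a family of p-bounded degree in R1's class has a representation in
  R1's class (same shape: dimension `≤ (n+2)^c`, volume `≤ c (n+1)`) with, in addition, `|E n i| ≤ (n+2)^c`;
* `orbitRestorationLinearVolumeQP_iff_polyEdge` — hence R1 is EQUIVALENT to its restriction to pattern
  families with polynomially many edges (linear volume, polynomial dimension AND polynomial edge count).

Honest framing: a normal form (the degree half of `VP`; the complexity half is untouched); it shrinks the
hypothesis class of the open stub to patterns with `O(n)` vertices and `n^{O(1)}` edges but proves nothing about
their treewidth.  R1, the crux and VP ≠ VNP are not moved.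
-/

noncomputable section

open MvPolynomial

-- `Summit.ValiantsHypothesis.ValiantsHypothesis.…` is the tree's single-conjunct layout (Sub = Summit).
set_option linter.dupNamespace false

namespace Summit.ValiantsHypothesis.ValiantsHypothesis.Theorems

namespace EdgeTruncation

open Literature.Computability.AlgebraicComplexity HomPolyBasics
open Summit.ValiantsHypothesis.ValiantsHypothesis.Theses.MonotoneRestoration

/-- A scalar multiple of a homomorphism polynomial has no monomial of degree `≠ |E|`. [folklore] -/
theorem coeff_C_mul_homPoly_eq_zero {n a b : ℕ} (E : Multiset (Fin a × Fin b)) (α : ℂ)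
    {s : (Fin n × Fin n) →₀ ℕ} (hs : s.degree ≠ Multiset.card E) :
    coeff s (C α * homPoly E n ℂ) = 0 := by
  rw [coeff_C_mul, (isHomogeneous_homPoly (K := ℂ) E n).coeff_eq_zero hs, mul_zero]

/-- **Edge truncation at one level.**  If a combination `Σ_i α_i · hom_{F_i,n}` of homomorphism polynomials has
total degree `≤ d`, then it equals its sub-sum over the patterns with at most `d` edges: the summands of each
degree `D > d` are homogeneous of degree `D` and sum to the (vanishing) degree-`D` component. [folklore] -/
theorem sum_homPoly_eq_sum_filter_card_le {n m : ℕ} (a b : Fin m → ℕ)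
    (E : (i : Fin m) → Multiset (Fin (a i) × Fin (b i))) (α : Fin m → ℂ) (d : ℕ)
    (hd : (∑ i, C (α i) * homPoly (E i) n ℂ).totalDegree ≤ d) :
    ∑ i, C (α i) * homPoly (E i) n ℂ =
      ∑ i ∈ Finset.univ.filter (fun i => Multiset.card (E i) ≤ d), C (α i) * homPoly (E i) n ℂ := by
  classical
  set f := ∑ i, C (α i) * homPoly (E i) n ℂ with hf
  have hsplit := Finset.sum_filter_add_sum_filter_not Finset.univ
    (fun i => Multiset.card (E i) ≤ d) (fun i => C (α i) * homPoly (E i) n ℂ)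
  -- the wide part `g` vanishes coefficient by coefficient
  suffices hg : ∑ i ∈ Finset.univ.filter (fun i => ¬ Multiset.card (E i) ≤ d),
      C (α i) * homPoly (E i) n ℂ = 0 by
    rw [hf, ← hsplit, hg, add_zero]
  ext s
  rw [coeff_sum, coeff_zero]
  by_cases hdeg : s.degree ≤ d
  · -- low-degree monomial: every wide summand misses it
    exact Finset.sum_eq_zero fun i hi => by
      have hi' := (Finset.mem_filter.1 hi).2
      exact coeff_C_mul_homPoly_eq_zero (E i) (α i) (by omega)
  · -- high-degree monomial: the whole sum and the narrow summands miss it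
    have hfs : coeff s f = 0 :=
      coeff_eq_zero_of_totalDegree_lt (lt_of_le_of_lt hd (by rw [← Finsupp.degree_apply]; omega))
    have hlow : ∑ i ∈ Finset.univ.filter (fun i => Multiset.card (E i) ≤ d),
        coeff s (C (α i) * homPoly (E i) n ℂ) = 0 :=
      Finset.sum_eq_zero fun i hi => by
        have hi' := (Finset.mem_filter.1 hi).2
        exact coeff_C_mul_homPoly_eq_zero (E i) (α i) (by omega)
    have := congrArg (coeff s) hsplit
    rw [coeff_add, coeff_sum, coeff_sum, hlow, zero_add, ← hf, hfs] at this
    exact this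

/-- **Edge truncation, family form.**  A family of p-bounded total degree (in particular every `VP` family) in
R1's hypothesis class — level by level a combination of `≤ (n+2)^c` homomorphism polynomials of bipartite patterns
with `≤ c (n+1)` vertices — has such a representation in which, moreover, every pattern has `≤ (n+2)^c'` edges
(one constant `c'` for dimension, volume and edge count).  Obtained by dropping, at each level, the patterns
with more edges than the total degree (`sum_homPoly_eq_sum_filter_card_le`) and re-indexing. [folklore] -/
theorem exists_edgeTruncated (f : (n : ℕ) → MvPolynomial (Fin n × Fin n) ℂ)
    (hdeg : IsPBounded fun n => (f n).totalDegree)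
    (h : ∃ (c : ℕ) (m : ℕ → ℕ) (a b : (n : ℕ) → Fin (m n) → ℕ)
      (E : (n : ℕ) → (i : Fin (m n)) → Multiset (Fin (a n i) × Fin (b n i))) (α : (n : ℕ) → Fin (m n) → ℂ),
      (∀ n, m n ≤ (n + 2) ^ c) ∧ (∀ n i, a n i + b n i ≤ c * (n + 1)) ∧
      ∀ n, f n = ∑ i : Fin (m n), MvPolynomial.C (α n i) * homPoly (E n i) n ℂ) :
    ∃ (c : ℕ) (m : ℕ → ℕ) (a b : (n : ℕ) → Fin (m n) → ℕ)
      (E : (n : ℕ) → (i : Fin (m n)) → Multiset (Fin (a n i) × Fin (b n i))) (α : (n : ℕ) → Fin (m n) → ℂ),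
      (∀ n, m n ≤ (n + 2) ^ c) ∧ (∀ n i, a n i + b n i ≤ c * (n + 1)) ∧
      (∀ n i, Multiset.card (E n i) ≤ (n + 2) ^ c) ∧
      ∀ n, f n = ∑ i : Fin (m n), MvPolynomial.C (α n i) * homPoly (E n i) n ℂ := by
  classical
  obtain ⟨c, m, a, b, E, α, hm, hvol, hf⟩ := h
  obtain ⟨c₀, hc₀⟩ := hdeg
  -- the surviving indices at level `n`, re-indexed by `Fin`
  let S : (n : ℕ) → Finset (Fin (m n)) := fun n =>
    Finset.univ.filter fun i => Multiset.card (E n i) ≤ (f n).totalDegree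
  let m' : ℕ → ℕ := fun n => (S n).card
  let e : (n : ℕ) → Fin (m' n) ≃ S n := fun n => (S n).equivFin.symm
  let ι : (n : ℕ) → Fin (m' n) → Fin (m n) := fun n j => (e n j : Fin (m n))
  refine ⟨max c (c₀ + 1), m', fun n j => a n (ι n j), fun n j => b n (ι n j), fun n j => E n (ι n j),
    fun n j => α n (ι n j), fun n => ?_, fun n j => ?_, fun n j => ?_, fun n => ?_⟩
  · -- dimension: `|S n| ≤ m n ≤ (n+2)^c ≤ (n+2)^(max c (c₀+1))`
    calc m' n ≤ m n := (Finset.card_filter_le _ _).trans (by simp)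
      _ ≤ (n + 2) ^ c := hm n
      _ ≤ (n + 2) ^ max c (c₀ + 1) := Nat.pow_le_pow_right (by omega) (le_max_left _ _)
  · -- volume
    exact (hvol n (ι n j)).trans (Nat.mul_le_mul_right _ (le_max_left _ _))
  · -- edge count: `|E| ≤ deg (f n) ≤ n^c₀ + c₀ ≤ (n+2)^(c₀+1)`
    have hj : Multiset.card (E n (ι n j)) ≤ (f n).totalDegree := (Finset.mem_filter.1 (e n j).2).2
    calc Multiset.card (E n (ι n j)) ≤ (f n).totalDegree := hj
      _ ≤ n ^ c₀ + c₀ := hc₀ n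
      _ ≤ (n + 2) ^ (c₀ + 1) := pow_add_le_add_two_pow n c₀
      _ ≤ (n + 2) ^ max c (c₀ + 1) := Nat.pow_le_pow_right (by omega) (le_max_right _ _)
  · -- the representation: truncate, then re-index the filtered sum by `Fin (m' n)`
    have htr := sum_homPoly_eq_sum_filter_card_le (a n) (b n) (E n) (α n) (f n).totalDegree
      (by rw [← hf n])
    rw [hf n, htr, ← Finset.sum_coe_sort (S n)]
    exact (Fintype.sum_equiv (e n) _ _ fun j => rfl).symm

/-- `VP` families have p-bounded total degree (half of `IsPFamily`). [folklore] -/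
theorem isPBounded_totalDegree_of_isVPFamily {f : (n : ℕ) → MvPolynomial (Fin n × Fin n) ℂ}
    (hf : IsVPFamily f) : IsPBounded fun n => (f n).totalDegree :=
  hf.1.2

/-- **R1 is equivalent to its polynomial-edge restriction.**  `OrbitRestorationLinearVolumeQP` holds iff it
holds for the `VP` families presented, level by level, by `≤ (n+2)^c` homomorphism polynomials of bipartite
patterns with `≤ c (n+1)` vertices AND `≤ (n+2)^c` edges each: the open stub `stub_lvNarrowSpan` may assume
patterns with `O(n)` vertices and `n^{O(1)}` (parallel) edges. [folklore] -/
theorem orbitRestorationLinearVolumeQP_iff_polyEdge :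
    OrbitRestorationLinearVolumeQP ↔
      ∀ f : (n : ℕ) → MvPolynomial (Fin n × Fin n) ℂ, IsVPFamily f →
        (∃ (c : ℕ) (m : ℕ → ℕ) (a b : (n : ℕ) → Fin (m n) → ℕ)
            (E : (n : ℕ) → (i : Fin (m n)) → Multiset (Fin (a n i) × Fin (b n i)))
            (α : (n : ℕ) → Fin (m n) → ℂ),
          (∀ n, m n ≤ (n + 2) ^ c) ∧ (∀ n i, a n i + b n i ≤ c * (n + 1)) ∧
            (∀ n i, Multiset.card (E n i) ≤ (n + 2) ^ c) ∧
            ∀ n, f n = ∑ i : Fin (m n), MvPolynomial.C (α n i) * homPoly (E n i) n ℂ) →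
        ∃ c : ℕ, ∀ n : ℕ, ∃ (G : Type) (_ : Fintype G) (C : LabelledArithCircuit ℂ (Fin n × Fin n) Unit G),
          C.IsSymmetric (Equiv.Perm (Fin n)) ∧ C.eval (C.output ()) = f n ∧
            C.orbitSize (Equiv.Perm (Fin n)) ≤ 2 ^ ((Nat.log 2 n + c) ^ c) := by
  constructor
  · intro hR1 f hVP h
    obtain ⟨c, m, a, b, E, α, hm, hvol, -, hf⟩ := h
    exact hR1 f hVP ⟨c, m, a, b, E, α, hm, hvol, hf⟩
  · intro h f hVP hLV
    exact h f hVP (exists_edgeTruncated f (isPBounded_totalDegree_of_isVPFamily hVP) hLV)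

end EdgeTruncation

end Summit.ValiantsHypothesis.ValiantsHypothesis.Theorems

end
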